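import Summits.QuantumFields.YangMills.Theorems.BalabanUVNodesRateCarriersOfRecord11
import Summits.QuantumFields.YangMills.Theorems.BalabanUVNodesN22AtRecordStrip
import Summits.QuantumFields.YangMills.Theorems.BalabanUVNodesN22AtRecordAnalytic

/-!
# BalabanUVNodes ∕ node N22 = NE9 AT THE RATE-RECORD HOME `YMDAG.UVSplit.RRec₁₁ 𝔯` — THE ABSTRACT SLOTS AT THE HOME's BUNDLES (any U3 objects, tower or
# fixed-carrier reading): `N22At (u3OfRecord₁₁ θ u k)` and `S_N22 (RRec₁₁ 𝔯)` from (P) + (O) + ONE regularity letter at the level-`k` objects, the window ∕ moduli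
# clauses of the -a closers DISCHARGED BY `rfl` and the letter equations stated on the objects' OWN letter block — (A′) strip, (A) sup, (R₂) second differences

Cell `pub-ymgap`, HUMAN RULING D-0062 (Track A), seat `pub-ymgap-dag-n22-e` ((T-RATE) pen; R134 s2), generation 0, module 4.  THEOREMS ONLY (0 `def`); imports layer B
(`BalabanUVNodesRateCarriersOfRecord11`, p457330: `RRec₁₁`, `u3OfRecord₁₁`, `s_N22_rRec₁₁_iff`) and the -a seat's bundle-level closers of record
(`BalabanUVNodesN22AtRecordStrip` p428115: `n22At_of_oscStrip`; `…AtRecordAnalytic` p421057: `n22At_of_oscAnalytic`; `…AtRecord` p419962: `n22At_of_oscSecondDiff`).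
`--supports stmt-QuantumFields-19676` (K3 `SpineGivenEndpointR11`).

WHY.  Module 3 (`BalabanUVNodesN22AtRateRecord11`) closes `S_N22 (RRec₁₁ 𝔯)` from node N18's STUB for TOWER readings (`t.objects ℓ`), the oscillation input (O) being
DERIVED along the tower.  A reading whose U3 objects are NOT presented as a tower — e.g. the fixed-carrier reading `Node00.U3Objects₁₁.ofFixed C EA EB ℓ` of def-W1's
history functional (`Node00.W1.functional`, `Node00/HistoryTermsOfRecord.lean`), or any per-run-length family — is served by the -a seat's ABSTRACT slots, which take (O)
as a displayed hypothesis at the bundle.  At the home's bundle `u3OfRecord₁₁ θ u k` their bookkeeping clauses `u.W = Window u.γ`, `u.Λ = fun k i => u.C₉·u.ω^(k−i)` hold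
BY `rfl`, so what remains is exactly: (P), (O), the letter, the signs, and two LETTER EQUATIONS on `u`'s block (`u.ω`, `u.C₉` as the slot's formulas in `u.θ₅`, `θ.γ` and the
letter's constants) — i.e. how the reading must DEFINE its `ω, C₉`.  For def-W1's object (P) is a THEOREM (`Node00.W1.functional_prefixDependenceOn`) and dag-n22-c's
`…N22W1ActivityStrip.supLetter_functional_of_youngHolo` (p457296) supplies the (A) letter from the activity side; (O) = node N18.
WHAT.  §1 bundle level: `n22At_u3OfRecord₁₁_of_oscStrip` ∕ `_of_oscAnalytic` ∕ `_of_oscSecondDiff`.  §2 record level (θ-form ⇒ `S_N22 (RRec₁₁ 𝔯)`):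
`s_N22_rRec₁₁_of_oscStrip` ∕ `_of_oscAnalytic` ∕ `_of_oscSecondDiff`.
HONEST FRAMING.  Count-neutral kernel bookkeeping BY NAME; (P), (O), the letter and the letter equations are DISPLAYED hypotheses; the reading `𝔯` is RESIDUAL (a skeleton
quoting `S_N22 (RRec₁₁ 𝔯)` NAMES its `𝔯`); NE5 ∕ NE9 NOT IN PRINT, NOT PROVED; no node discharged; one finite four-torus programme at fixed ε — NOT infinite volume, NOT OS
on ℝ⁴, NOT a mass gap, NOT Clay.  0 `sorry`, 0 `def`, standard axioms.
-/

noncomputable section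

namespace YMDAG.N22

open Set Metric
open scoped BigOperators
open Literature.MathematicalPhysics.QuantumFieldTheory.Balaban1983to89
open Literature.MathematicalPhysics.QuantumFieldTheory.Balaban1983to89.T4Continuum
open Literature.MathematicalPhysics.QuantumFieldTheory.Balaban1983to89.T4OutputRate
open Literature.MathematicalPhysics.QuantumFieldTheory.Balaban1983to89.Node00 (Stage11Params IsDatumOfRecord₁₁C U3Objects₁₁)
open YMDAG.UVSplit

variable {N : ℕ} [NeZero N]

/-! ## §1 The abstract slots at the home's bundle `u3OfRecord₁₁ θ u k` -/

section Bundle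

variable {F : T4Family} (θ : Stage11Params F N) (u : U3Objects₁₁) (k : ℕ)

/-- **THE STRIP SLOT (A′) AT THE HOME's LEVEL-`k` BUNDLE.**  (P) prefix dependence of `u.EA k` on `]0, θ.γ]`, (O) oscillation fading with constant `C₀ > 0` at the
block's NE5 rate `u.θ₅ > 0`, (A′) ONE complex-differentiable extension per young-coupling section on a set containing the open `r`-discs about `]0, θ.γ]` with the
derivative letter `L·μ^{age−1}·e^{−κd}`, `u.θ₅ ≤ μ`, `C₀ ≤ 2Lr`, `0 < s < 1`, and the LETTER EQUATIONS `u.ω = u.θ₅^{1−s}μ^{s}`,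
`u.C₉ = (32∕(s²·min(r∕2, θ.γ∕2)))·C₀^{1−s}(2Lr)^{s}∕(u.θ₅^{1−s}μ^{s})` ⟹ `N22At (u3OfRecord₁₁ θ u k)` — `YMDAG.N22.n22At_of_oscStrip` with its window and moduli clauses
by `rfl`. [folklore] -/
theorem n22At_u3OfRecord₁₁_of_oscStrip {C₀ L μ r s : ℝ}
    (hP : PrefixDependenceOn (u.EA k) (Window θ.γ))
    (hO : ∀ g ∈ Window θ.γ, ∀ g' ∈ Window θ.γ, ∀ (U : (u.levelCarriers k).BgA) (X : (u.levelCarriers k).Dom) (a : ℕ), a ≤ (u.levelCarriers k).scale X →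
      (∀ n, a ≤ n → g n = g' n) → |u.EA k g U X - u.EA k g' U X| ≤ C₀ * u.θ₅ ^ ((u.levelCarriers k).scale X - a) * Real.exp (-(u.κ * (u.levelCarriers k).d X)))
    (hA : ∀ g ∈ Window θ.γ, ∀ (U : (u.levelCarriers k).BgA) (X : (u.levelCarriers k).Dom) (i : ℕ), i < (u.levelCarriers k).scale X →
      ∃ (Fz : ℂ → ℂ) (Dset : Set ℂ), DifferentiableOn ℂ Fz Dset ∧
        (∀ z ∈ Dset, ‖deriv Fz z‖ ≤ L * μ ^ ((u.levelCarriers k).scale X - 1 - i) * Real.exp (-(u.κ * (u.levelCarriers k).d X))) ∧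
        (∀ t ∈ Ioc (0 : ℝ) θ.γ, ball (t : ℂ) r ⊆ Dset) ∧ (∀ t ∈ Ioc (0 : ℝ) θ.γ, Fz t = (u.EA k (Function.update g i t) U X : ℂ)))
    (hC₀ : 0 < C₀) (hθ : 0 < u.θ₅) (hL : 0 < L) (hθμ : u.θ₅ ≤ μ) (hCL : C₀ ≤ 2 * (L * r)) (hr : 0 < r) (hγ : 0 < θ.γ) (hs0 : 0 < s) (hs1 : s < 1)
    (hω : u.ω = u.θ₅ ^ (1 - s) * μ ^ s)
    (hC₉ : u.C₉ = 32 / (s ^ 2 * min (r / 2) (θ.γ / 2)) * (C₀ ^ (1 - s) * (2 * (L * r)) ^ s) / (u.θ₅ ^ (1 - s) * μ ^ s)) :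
    N22At (u3OfRecord₁₁ θ u k) :=
  n22At_of_oscStrip (u3OfRecord₁₁ θ u k) rfl hP hO hA hC₀ hθ hL hθμ hCL hr hγ hs0 hs1 hω rfl hC₉

/-- **THE ANALYTIC SLOT (A) AT THE HOME's LEVEL-`k` BUNDLE** (sup letter `M·μ^{age−1}·e^{−κd}` on a set containing the CLOSED `r`-discs; `C₀ ≤ 2M`; letter equations
`u.ω = u.θ₅^{1−s}μ^{s}`, `u.C₉ = (32∕(s²·min(r∕2, θ.γ∕2)))·C₀^{1−s}(2M)^{s}∕(u.θ₅^{1−s}μ^{s})`) ⟹ `N22At (u3OfRecord₁₁ θ u k)` — `YMDAG.N22.n22At_of_oscAnalytic`. [folklore] -/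
theorem n22At_u3OfRecord₁₁_of_oscAnalytic {C₀ M μ r s : ℝ}
    (hP : PrefixDependenceOn (u.EA k) (Window θ.γ))
    (hO : ∀ g ∈ Window θ.γ, ∀ g' ∈ Window θ.γ, ∀ (U : (u.levelCarriers k).BgA) (X : (u.levelCarriers k).Dom) (a : ℕ), a ≤ (u.levelCarriers k).scale X →
      (∀ n, a ≤ n → g n = g' n) → |u.EA k g U X - u.EA k g' U X| ≤ C₀ * u.θ₅ ^ ((u.levelCarriers k).scale X - a) * Real.exp (-(u.κ * (u.levelCarriers k).d X)))
    (hA : ∀ g ∈ Window θ.γ, ∀ (U : (u.levelCarriers k).BgA) (X : (u.levelCarriers k).Dom) (i : ℕ), i < (u.levelCarriers k).scale X →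
      ∃ (Fz : ℂ → ℂ) (Dset : Set ℂ), DifferentiableOn ℂ Fz Dset ∧
        (∀ z ∈ Dset, ‖Fz z‖ ≤ M * μ ^ ((u.levelCarriers k).scale X - 1 - i) * Real.exp (-(u.κ * (u.levelCarriers k).d X))) ∧
        (∀ t ∈ Ioc (0 : ℝ) θ.γ, closedBall (t : ℂ) r ⊆ Dset) ∧ (∀ t ∈ Ioc (0 : ℝ) θ.γ, Fz t = (u.EA k (Function.update g i t) U X : ℂ)))
    (hC₀ : 0 < C₀) (hθ : 0 < u.θ₅) (hM : 0 < M) (hθμ : u.θ₅ ≤ μ) (hCM : C₀ ≤ 2 * M) (hr : 0 < r) (hγ : 0 < θ.γ) (hs0 : 0 < s) (hs1 : s < 1)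
    (hω : u.ω = u.θ₅ ^ (1 - s) * μ ^ s)
    (hC₉ : u.C₉ = 32 / (s ^ 2 * min (r / 2) (θ.γ / 2)) * (C₀ ^ (1 - s) * (2 * M) ^ s) / (u.θ₅ ^ (1 - s) * μ ^ s)) :
    N22At (u3OfRecord₁₁ θ u k) :=
  n22At_of_oscAnalytic (u3OfRecord₁₁ θ u k) rfl hP hO hA hC₀ hθ hM hθμ hCM hr hγ hs0 hs1 hω rfl hC₉

/-- **THE SECOND-DIFFERENCE SLOT (R₂) AT THE HOME's LEVEL-`k` BUNDLE** ((P) + (O) with `C₀ ≥ 0` + second differences `≤ M·μ^{age−1}·e^{−κd}·d²`, `0 < ρ ≤ 1`,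
`u.θ₅ ≤ u.ω·ρ`, `μρ ≤ u.ω`, `0 < u.ω`; letter equation `u.C₉ = (4C₀∕θ.γ + M·θ.γ∕2)∕u.ω`) ⟹ `N22At (u3OfRecord₁₁ θ u k)` — `YMDAG.N22.n22At_of_oscSecondDiff`. [folklore] -/
theorem n22At_u3OfRecord₁₁_of_oscSecondDiff {C₀ M μ ρ : ℝ}
    (hP : PrefixDependenceOn (u.EA k) (Window θ.γ))
    (hO : ∀ g ∈ Window θ.γ, ∀ g' ∈ Window θ.γ, ∀ (U : (u.levelCarriers k).BgA) (X : (u.levelCarriers k).Dom) (a : ℕ), a ≤ (u.levelCarriers k).scale X →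
      (∀ n, a ≤ n → g n = g' n) → |u.EA k g U X - u.EA k g' U X| ≤ C₀ * u.θ₅ ^ ((u.levelCarriers k).scale X - a) * Real.exp (-(u.κ * (u.levelCarriers k).d X)))
    (hR2 : ∀ g ∈ Window θ.γ, ∀ (U : (u.levelCarriers k).BgA) (X : (u.levelCarriers k).Dom) (i : ℕ), i < (u.levelCarriers k).scale X → ∀ t d : ℝ, 0 < d →
      t - d ∈ Ioc (0 : ℝ) θ.γ → t + d ∈ Ioc (0 : ℝ) θ.γ →
        |u.EA k (Function.update g i (t + d)) U X - 2 * u.EA k (Function.update g i t) U X + u.EA k (Function.update g i (t - d)) U X| ≤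
          M * μ ^ ((u.levelCarriers k).scale X - 1 - i) * Real.exp (-(u.κ * (u.levelCarriers k).d X)) * d ^ 2)
    (hC₀ : 0 ≤ C₀) (hθ0 : 0 ≤ u.θ₅) (hM : 0 ≤ M) (hμ : 0 ≤ μ) (hγ : 0 < θ.γ) (hρ0 : 0 < ρ) (hρ1 : ρ ≤ 1) (hθωρ : u.θ₅ ≤ u.ω * ρ) (hμρω : μ * ρ ≤ u.ω)
    (hω0 : 0 < u.ω) (hC₉ : u.C₉ = (4 * C₀ / θ.γ + M * θ.γ / 2) / u.ω) :
    N22At (u3OfRecord₁₁ θ u k) :=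
  n22At_of_oscSecondDiff (u3OfRecord₁₁ θ u k) rfl hP hO hR2 hC₀ hθ0 hM hμ hγ hρ0 hρ1 hθωρ hμρω hω0 rfl hC₉

end Bundle

/-! ## §2 … and at the record: `S_N22 (RRec₁₁ 𝔯)` from the slot at every run length of every admissible tuple's objects (θ-form) -/

variable (𝔯 : RateReading₁₁ N)

/-- **`S_N22 (RRec₁₁ 𝔯)` FROM THE STRIP SLOT (A′) AT EVERY RUN LENGTH** of the reading's U3 objects, at every admissible Stage-11 tuple with provisos (θ-form; the slot's
constants `C₀ L μ r s` may depend on everything). [folklore] -/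
theorem s_N22_rRec₁₁_of_oscStrip
    (hslot : ∀ (F : T4Family) (θ : Stage11Params F N), θ.Provisos₁₁ → θ.Admissible → ∀ (g₀ : ℕ → ℝ) (os : List (ULoop F)) (k : ℕ),
      ∃ C₀ L μ r s : ℝ,
        PrefixDependenceOn ((𝔯.lit F θ g₀ os).u3.EA k) (Window θ.γ) ∧
        (∀ g ∈ Window θ.γ, ∀ g' ∈ Window θ.γ, ∀ (U : ((𝔯.lit F θ g₀ os).u3.levelCarriers k).BgA) (X : ((𝔯.lit F θ g₀ os).u3.levelCarriers k).Dom) (a : ℕ),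
          a ≤ ((𝔯.lit F θ g₀ os).u3.levelCarriers k).scale X → (∀ n, a ≤ n → g n = g' n) →
            |(𝔯.lit F θ g₀ os).u3.EA k g U X - (𝔯.lit F θ g₀ os).u3.EA k g' U X| ≤
              C₀ * (𝔯.lit F θ g₀ os).u3.θ₅ ^ (((𝔯.lit F θ g₀ os).u3.levelCarriers k).scale X - a) *
                Real.exp (-((𝔯.lit F θ g₀ os).u3.κ * ((𝔯.lit F θ g₀ os).u3.levelCarriers k).d X))) ∧
        (∀ g ∈ Window θ.γ, ∀ (U : ((𝔯.lit F θ g₀ os).u3.levelCarriers k).BgA) (X : ((𝔯.lit F θ g₀ os).u3.levelCarriers k).Dom) (i : ℕ),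
          i < ((𝔯.lit F θ g₀ os).u3.levelCarriers k).scale X → ∃ (Fz : ℂ → ℂ) (Dset : Set ℂ), DifferentiableOn ℂ Fz Dset ∧
            (∀ z ∈ Dset, ‖deriv Fz z‖ ≤ L * μ ^ (((𝔯.lit F θ g₀ os).u3.levelCarriers k).scale X - 1 - i) *
              Real.exp (-((𝔯.lit F θ g₀ os).u3.κ * ((𝔯.lit F θ g₀ os).u3.levelCarriers k).d X))) ∧
            (∀ t ∈ Ioc (0 : ℝ) θ.γ, ball (t : ℂ) r ⊆ Dset) ∧ (∀ t ∈ Ioc (0 : ℝ) θ.γ, Fz t = ((𝔯.lit F θ g₀ os).u3.EA k (Function.update g i t) U X : ℂ))) ∧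
        0 < C₀ ∧ 0 < (𝔯.lit F θ g₀ os).u3.θ₅ ∧ 0 < L ∧ (𝔯.lit F θ g₀ os).u3.θ₅ ≤ μ ∧ C₀ ≤ 2 * (L * r) ∧ 0 < r ∧ 0 < s ∧ s < 1 ∧
        (𝔯.lit F θ g₀ os).u3.ω = (𝔯.lit F θ g₀ os).u3.θ₅ ^ (1 - s) * μ ^ s ∧
        (𝔯.lit F θ g₀ os).u3.C₉ = 32 / (s ^ 2 * min (r / 2) (θ.γ / 2)) * (C₀ ^ (1 - s) * (2 * (L * r)) ^ s) /
          ((𝔯.lit F θ g₀ os).u3.θ₅ ^ (1 - s) * μ ^ s)) :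
    S_N22 (RRec₁₁ 𝔯) := by
  rw [s_N22_rRec₁₁_iff]
  intro F D h g₀ os k
  obtain ⟨C₀, L, μ, r, s, hP, hO, hA, hC₀, hθ, hL, hθμ, hCL, hr, hs0, hs1, hω, hC₉⟩ := hslot F h.params h.provisos h.admissible g₀ os k
  exact n22At_u3OfRecord₁₁_of_oscStrip h.params _ k hP hO hA hC₀ hθ hL hθμ hCL hr h.gamma_pos hs0 hs1 hω hC₉

/-- **`S_N22 (RRec₁₁ 𝔯)` FROM THE ANALYTIC SLOT (A) AT EVERY RUN LENGTH** (θ-form). [folklore] -/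
theorem s_N22_rRec₁₁_of_oscAnalytic
    (hslot : ∀ (F : T4Family) (θ : Stage11Params F N), θ.Provisos₁₁ → θ.Admissible → ∀ (g₀ : ℕ → ℝ) (os : List (ULoop F)) (k : ℕ),
      ∃ C₀ M μ r s : ℝ,
        PrefixDependenceOn ((𝔯.lit F θ g₀ os).u3.EA k) (Window θ.γ) ∧
        (∀ g ∈ Window θ.γ, ∀ g' ∈ Window θ.γ, ∀ (U : ((𝔯.lit F θ g₀ os).u3.levelCarriers k).BgA) (X : ((𝔯.lit F θ g₀ os).u3.levelCarriers k).Dom) (a : ℕ),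
          a ≤ ((𝔯.lit F θ g₀ os).u3.levelCarriers k).scale X → (∀ n, a ≤ n → g n = g' n) →
            |(𝔯.lit F θ g₀ os).u3.EA k g U X - (𝔯.lit F θ g₀ os).u3.EA k g' U X| ≤
              C₀ * (𝔯.lit F θ g₀ os).u3.θ₅ ^ (((𝔯.lit F θ g₀ os).u3.levelCarriers k).scale X - a) *
                Real.exp (-((𝔯.lit F θ g₀ os).u3.κ * ((𝔯.lit F θ g₀ os).u3.levelCarriers k).d X))) ∧
        (∀ g ∈ Window θ.γ, ∀ (U : ((𝔯.lit F θ g₀ os).u3.levelCarriers k).BgA) (X : ((𝔯.lit F θ g₀ os).u3.levelCarriers k).Dom) (i : ℕ),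
          i < ((𝔯.lit F θ g₀ os).u3.levelCarriers k).scale X → ∃ (Fz : ℂ → ℂ) (Dset : Set ℂ), DifferentiableOn ℂ Fz Dset ∧
            (∀ z ∈ Dset, ‖Fz z‖ ≤ M * μ ^ (((𝔯.lit F θ g₀ os).u3.levelCarriers k).scale X - 1 - i) *
              Real.exp (-((𝔯.lit F θ g₀ os).u3.κ * ((𝔯.lit F θ g₀ os).u3.levelCarriers k).d X))) ∧
            (∀ t ∈ Ioc (0 : ℝ) θ.γ, closedBall (t : ℂ) r ⊆ Dset) ∧
            (∀ t ∈ Ioc (0 : ℝ) θ.γ, Fz t = ((𝔯.lit F θ g₀ os).u3.EA k (Function.update g i t) U X : ℂ))) ∧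
        0 < C₀ ∧ 0 < (𝔯.lit F θ g₀ os).u3.θ₅ ∧ 0 < M ∧ (𝔯.lit F θ g₀ os).u3.θ₅ ≤ μ ∧ C₀ ≤ 2 * M ∧ 0 < r ∧ 0 < s ∧ s < 1 ∧
        (𝔯.lit F θ g₀ os).u3.ω = (𝔯.lit F θ g₀ os).u3.θ₅ ^ (1 - s) * μ ^ s ∧
        (𝔯.lit F θ g₀ os).u3.C₉ = 32 / (s ^ 2 * min (r / 2) (θ.γ / 2)) * (C₀ ^ (1 - s) * (2 * M) ^ s) /
          ((𝔯.lit F θ g₀ os).u3.θ₅ ^ (1 - s) * μ ^ s)) :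
    S_N22 (RRec₁₁ 𝔯) := by
  rw [s_N22_rRec₁₁_iff]
  intro F D h g₀ os k
  obtain ⟨C₀, M, μ, r, s, hP, hO, hA, hC₀, hθ, hM, hθμ, hCM, hr, hs0, hs1, hω, hC₉⟩ := hslot F h.params h.provisos h.admissible g₀ os k
  exact n22At_u3OfRecord₁₁_of_oscAnalytic h.params _ k hP hO hA hC₀ hθ hM hθμ hCM hr h.gamma_pos hs0 hs1 hω hC₉

/-- **`S_N22 (RRec₁₁ 𝔯)` FROM THE SECOND-DIFFERENCE SLOT (R₂) AT EVERY RUN LENGTH** (θ-form). [folklore] -/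
theorem s_N22_rRec₁₁_of_oscSecondDiff
    (hslot : ∀ (F : T4Family) (θ : Stage11Params F N), θ.Provisos₁₁ → θ.Admissible → ∀ (g₀ : ℕ → ℝ) (os : List (ULoop F)) (k : ℕ),
      ∃ C₀ M μ ρ : ℝ,
        PrefixDependenceOn ((𝔯.lit F θ g₀ os).u3.EA k) (Window θ.γ) ∧
        (∀ g ∈ Window θ.γ, ∀ g' ∈ Window θ.γ, ∀ (U : ((𝔯.lit F θ g₀ os).u3.levelCarriers k).BgA) (X : ((𝔯.lit F θ g₀ os).u3.levelCarriers k).Dom) (a : ℕ),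
          a ≤ ((𝔯.lit F θ g₀ os).u3.levelCarriers k).scale X → (∀ n, a ≤ n → g n = g' n) →
            |(𝔯.lit F θ g₀ os).u3.EA k g U X - (𝔯.lit F θ g₀ os).u3.EA k g' U X| ≤
              C₀ * (𝔯.lit F θ g₀ os).u3.θ₅ ^ (((𝔯.lit F θ g₀ os).u3.levelCarriers k).scale X - a) *
                Real.exp (-((𝔯.lit F θ g₀ os).u3.κ * ((𝔯.lit F θ g₀ os).u3.levelCarriers k).d X))) ∧
        (∀ g ∈ Window θ.γ, ∀ (U : ((𝔯.lit F θ g₀ os).u3.levelCarriers k).BgA) (X : ((𝔯.lit F θ g₀ os).u3.levelCarriers k).Dom) (i : ℕ),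
          i < ((𝔯.lit F θ g₀ os).u3.levelCarriers k).scale X → ∀ t d : ℝ, 0 < d → t - d ∈ Ioc (0 : ℝ) θ.γ → t + d ∈ Ioc (0 : ℝ) θ.γ →
            |(𝔯.lit F θ g₀ os).u3.EA k (Function.update g i (t + d)) U X - 2 * (𝔯.lit F θ g₀ os).u3.EA k (Function.update g i t) U X +
                (𝔯.lit F θ g₀ os).u3.EA k (Function.update g i (t - d)) U X| ≤
              M * μ ^ (((𝔯.lit F θ g₀ os).u3.levelCarriers k).scale X - 1 - i) *
                Real.exp (-((𝔯.lit F θ g₀ os).u3.κ * ((𝔯.lit F θ g₀ os).u3.levelCarriers k).d X)) * d ^ 2) ∧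
        0 ≤ C₀ ∧ 0 ≤ (𝔯.lit F θ g₀ os).u3.θ₅ ∧ 0 ≤ M ∧ 0 ≤ μ ∧ 0 < ρ ∧ ρ ≤ 1 ∧
        (𝔯.lit F θ g₀ os).u3.θ₅ ≤ (𝔯.lit F θ g₀ os).u3.ω * ρ ∧ μ * ρ ≤ (𝔯.lit F θ g₀ os).u3.ω ∧ 0 < (𝔯.lit F θ g₀ os).u3.ω ∧
        (𝔯.lit F θ g₀ os).u3.C₉ = (4 * C₀ / θ.γ + M * θ.γ / 2) / (𝔯.lit F θ g₀ os).u3.ω) :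
    S_N22 (RRec₁₁ 𝔯) := by
  rw [s_N22_rRec₁₁_iff]
  intro F D h g₀ os k
  obtain ⟨C₀, M, μ, ρ, hP, hO, hR2, hC₀, hθ0, hM, hμ, hρ0, hρ1, hθωρ, hμρω, hω0, hC₉⟩ := hslot F h.params h.provisos h.admissible g₀ os k
  exact n22At_u3OfRecord₁₁_of_oscSecondDiff h.params _ k hP hO hR2 hC₀ hθ0 hM hμ h.gamma_pos hρ0 hρ1 hθωρ hμρω hω0 hC₉

end YMDAG.N22

end
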